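/-
Copyright: public-domain mathematics; typed transcription for the H21 Literature library (cell lit-balaban,
reader/typer seat r02 gen 5 = literature-prover-lit-balaban-r02-g5-0).

statement-level skeleton of published theorems with citation tags; proofs where landed; nothing here is a claim about the Yang–Mills mass gap

# Bałaban, *Propagators and renormalization transformations for lattice gauge theories. I*,
# Commun. Math. Phys. **95** (1984) 17–40 — the MAPS of the (1.132) carrier `B5Transfer133.Carrier133 (famG0 i) (fam i)` between
# the G side (product tori, `B5SettingP12Real.latticeSettingP12R`) and the G₀ side (tower, seat p37), and their `MapFacts` geometry

[cite: Balaban1984PropagatorsI]  T. Bałaban, Commun. Math. Phys. 95 (1984) 17–40.  p. 39 (1.132) (PDF p. 23): «G = G₀ + G₀∂P∂*G» — G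
and G₀ act on the SAME lattice `T_η` and the same sources; the carrier maps σ (unit sites), ι (sources), κ (cut-offs) of
`B5Transfer132.MapFacts` are the identity in the paper and the typing bijections `B5SiteBridgeP12.eFine/eUnit` here; p. 35
(1.108)–(1.109): the norms `|J|`, `‖J‖_α`, the cubes `Δ̃(y)`.

WHAT THIS MODULE ADDS (SKELETON row B5.Prop1.2, owner's census (vii), the (1.132) half).  Component-level dictionary for the
`MapFacts` fields `dist_le`, `tri`, `supp_map`, `cut_map`, `supNorm_map`, `holder_map`, `cutH_map`:
* `σR = eUnit⁻¹`, `κR ζ = ζ ∘ eFine`, `pullV F μ x = F (eFine x, μ)` (a real bond function read as a tower vector function;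
  `embA (pullV F) = F`);
* distances `T P K (σR y) (σR y′) = distSite y y′` (`dist_σR`), triangle `distSite_triangle'`; supports `inCube ↔ cubeT` under `σR`
  (`inCube_σR_iff`, `supp_pullV`, `cutIn_κR`); sup norms `supN`/`supNormV` of pulled functions ≤ (in fact =) `supNorm` of the bond
  function (`supN_pull_le`, `supNormV_pullV_le`, `supN_κR_le`); **Hölder**: p37's `holN P K ε` of a pulled component ≤ r19's
  `holderSeminormB5 ε` of the bond function (`holN_pull_le` — the pairs `|x − x′| ≤ 1, x ≠ x′` of `holN` are admissible pairs of
  `holderSeminormB5` with the same distance `distX_K_eq` and quotient), whence `holderV_pullV_le`, `cutHV_κR_le`.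
The source map ι on the three kinds is `pullV` kindwise once the G₀ side's source type is fixed (p37 `B5G0DiagTorus` / own
`B5TowerSourcesG0.LocT`).

HONEST SCOPE.  Bookkeeping for the located leaf `MapFacts` (identities in the paper); nothing analytic.
-/
import Mathlib
import Literature.MathematicalPhysics.QuantumFieldTheory.Balaban1983to89.B5G0BridgeP12
import Literature.MathematicalPhysics.QuantumFieldTheory.Balaban1983to89.B5SettingP12Real

open scoped BigOperators Matrix Real
open Finset Matrix

namespace Literature.MathematicalPhysics.QuantumFieldTheory.Balaban1983to89.B5Carrier132Maps

open Literature.MathematicalPhysics.QuantumFieldTheory.Balaban1983to89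
open Literature.MathematicalPhysics.QuantumFieldTheory.Balaban1983to89.B5Prop11Plancherel (Tor fine)
open Literature.MathematicalPhysics.QuantumFieldTheory.Balaban1983to89.B5SiteBridgeP12 (nP MP eFine eUnit T_K_eq distX_K_eq
  inCube_K_iff)
open Literature.MathematicalPhysics.QuantumFieldTheory.Balaban1983to89.B5G0BridgeP12 (embA embA_apply)
open Literature.MathematicalPhysics.QuantumFieldTheory.Balaban1983to89.B5Prop12FieldsLattice (cubeT distU distSite cutInL cutSupL cutHL)
open Literature.MathematicalPhysics.QuantumFieldTheory.Balaban1983to89.B5RowSumsP12Lattice (distSite_triangle)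
open Literature.MathematicalPhysics.QuantumFieldTheory.Balaban1983to89.B5GpSettingTorus (inCube supNormV holderV cutHV dir0)
open Literature.MathematicalPhysics.QuantumFieldTheory.Balaban1983to89.B5Ineq137Torus (T distX supN holN le_supN supN_nonneg holN_nonneg
  T_nonneg eq_of_distX_eq_zero)
open Literature.MathematicalPhysics.QuantumFieldTheory.Balaban1983to89.LatticeNorms (supNorm supNorm_nonneg norm_le_supNorm holderSeminormB5
  holderSeminorm_nonneg holder_bound)

noncomputable section

variable (P : Params)

/-! ## §1 The maps -/

/-- **σ: unit sites of the G side ↦ unit sites of the tower** (`eUnit⁻¹`). [cite: Balaban1984PropagatorsI, (1.132) p.39, p.35 (T₁^{(k)})] -/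
def σR : Tor (MP P) → Site P P.K := (eUnit P).symm

/-- **κ: cut-offs of the G side ↦ cut-offs of the tower** (`ζ ∘ eFine`). [cite: Balaban1984PropagatorsI, (1.111) p.35] -/
def κR (ζ : Tor (fine (nP P) (MP P)) → ℝ) : Site P 0 → ℝ := fun x => ζ (eFine P x)

/-- **a real bond function read as a tower vector function**: `pullV F μ x = F (eFine x, μ)`. [cite: Balaban1984PropagatorsI, (1.18) p.20] -/
def pullV (F : Tor (fine (nP P) (MP P)) × Fin P.d → ℝ) : Fin P.d → Site P 0 → ℝ := fun μ x => F (eFine P x, μ)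

/-- `embA (pullV F) = F` (as a `ℂ`-valued bond function). [cite: Balaban1984PropagatorsI, (1.18) p.20] -/
theorem embA_pullV (F : Tor (fine (nP P) (MP P)) × Fin P.d → ℝ) : embA P (pullV P F) = fun b => (F b : ℂ) := by
  funext b
  obtain ⟨z, μ⟩ := b
  rw [embA_apply, pullV, Equiv.apply_symm_apply]

/-- `eUnit (σR y) = y`. [cite: Balaban1984PropagatorsI, p.35 (T₁^{(k)})] -/
@[simp] theorem eUnit_σR (y : Tor (MP P)) : eUnit P (σR P y) = y := (eUnit P).apply_symm_apply y

/-! ## §2 Distances and supports -/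

/-- **`dist_le` (equality): `|y − y′|` agrees through `σ`.** [cite: Balaban1984PropagatorsI, (1.110) p.35 (|y − y′|)] -/
theorem dist_σR (y y' : Tor (MP P)) : T P P.K (σR P y) (σR P y') = distSite (MP P) y y' := by
  rw [T_K_eq, eUnit_σR, eUnit_σR]

/-- **`tri`: the unit-lattice triangle inequality on the G side.** [cite: Balaban1984PropagatorsI, p.35 (|y − y′|)] -/
theorem distSite_triangle' (y y'' y' : Tor (MP P)) : distSite (MP P) y y' ≤ distSite (MP P) y y'' + distSite (MP P) y'' y' :=
  distSite_triangle (MP P) y y'' y'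

/-- cubes agree through `σ`: `x ∈ Δ̃(σ y)` iff `eFine x ∈ cubeT y`. [cite: Balaban1984PropagatorsI, p.35 (Δ̃(y))] -/
theorem inCube_σR_iff (x : Site P 0) (y : Tor (MP P)) : inCube P P.K x (σR P y) ↔ eFine P x ∈ cubeT (nP P) (MP P) y := by
  rw [inCube_K_iff, eUnit_σR]

/-- **`supp_map` (components): a bond function supported over `cubeT y′` pulls back to a tower vector function supported in `Δ̃(σ y′)`.**
[cite: Balaban1984PropagatorsI, Prop. 1.2 p.35 (supp J ⊂ Δ̃(y′))] -/
theorem supp_pullV (F : Tor (fine (nP P) (MP P)) × Fin P.d → ℝ) (y' : Tor (MP P))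
    (hF : ∀ b, F b ≠ 0 → b.1 ∈ cubeT (nP P) (MP P) y') :
    ∀ μ x, pullV P F μ x ≠ 0 → inCube P P.K x (σR P y') := by
  intro μ x hx
  rw [inCube_σR_iff]
  exact hF (eFine P x, μ) hx

/-- **`cut_map`: a cut-off supported in `cubeT y` pulls back to a cut-off supported in `Δ̃(σ y)`.** [cite: Balaban1984PropagatorsI, (1.111) p.35] -/
theorem cutIn_κR (ζ : Tor (fine (nP P) (MP P)) → ℝ) (y : Tor (MP P)) (hζ : cutInL (nP P) (MP P) ζ y) :
    ∀ x, κR P ζ x ≠ 0 → inCube P P.K x (σR P y) := by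
  intro x hx
  rw [inCube_σR_iff]
  exact hζ (eFine P x) hx

/-! ## §3 Sup norms -/

/-- a pulled component has sup norm at most the bond function's. [cite: Balaban1984PropagatorsI, (1.108) p.35] -/
theorem supN_pull_le (F : Tor (fine (nP P) (MP P)) × Fin P.d → ℝ) (μ : Fin P.d) :
    supN P (pullV P F μ) ≤ supNorm Finset.univ (fun b => (F b : ℂ)) := by
  refine Finset.sup'_le _ _ fun x _ => ?_
  have h := norm_le_supNorm (fun b => (F b : ℂ)) (Finset.mem_univ (eFine P x, μ))
  rwa [Complex.norm_real, Real.norm_eq_abs] at h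

/-- **`supNorm_map` (vector kind): `|pullV F| ≤ |F|`.** [cite: Balaban1984PropagatorsI, (1.108) p.35] -/
theorem supNormV_pullV_le (F : Tor (fine (nP P) (MP P)) × Fin P.d → ℝ) :
    supNormV P (pullV P F) ≤ supNorm Finset.univ (fun b => (F b : ℂ)) :=
  Finset.sup'_le _ _ fun μ _ => supN_pull_le P F μ

/-- **`|κ ζ| ≤ |ζ|`.** [cite: Balaban1984PropagatorsI, (1.111) p.35] -/
theorem supN_κR_le (ζ : Tor (fine (nP P) (MP P)) → ℝ) : supN P (κR P ζ) ≤ cutSupL (nP P) (MP P) ζ := by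
  refine Finset.sup'_le _ _ fun x _ => ?_
  have h := norm_le_supNorm ζ (Finset.mem_univ (eFine P x))
  rw [Real.norm_eq_abs] at h
  exact h

/-! ## §4 Hölder seminorms -/

/-- **the Hölder dictionary, one component**: p37's `holN P K ε` of the pulled function `x ↦ F (eFine x)` is at most r19's
`holderSeminormB5 ε` of `F` over the fine torus with any `sameDir` that holds on the diagonal bond direction — stated for a scalar
fine-torus function `F` with `sameDir := True` (cut-offs) and below for vector components. The pairs of `holN` (`|x − x′| ≤ 1`; `x = x′`
contributes 0) are admissible pairs of `holderSeminormB5` at the same distance (`distX_K_eq`). [cite: Balaban1984PropagatorsI, (1.109) p.35] -/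
theorem holN_comp_le (ε : ℝ) (F : Tor (fine (nP P) (MP P)) → ℝ) :
    holN P P.K ε (fun x => F (eFine P x))
      ≤ holderSeminormB5 ε (fun _ _ : Tor (fine (nP P) (MP P)) => True) (distU (nP P) (MP P)) Finset.univ F := by
  set H := holderSeminormB5 ε (fun _ _ : Tor (fine (nP P) (MP P)) => True) (distU (nP P) (MP P)) Finset.univ F with hH
  have hH0 : 0 ≤ H := holderSeminorm_nonneg _ _ _ _ _ _
  refine Finset.sup'_le _ _ fun p _ => ?_
  obtain ⟨x, x'⟩ := p
  dsimp only
  split_ifs with hle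
  · by_cases hxx : x = x'
    · subst hxx
      rw [sub_self, abs_zero, zero_div]
      exact hH0
    · have hpos : 0 < distX P P.K x x' :=
        lt_of_le_of_ne (by unfold distX; have := T_nonneg P 0 x x'; positivity) fun h => hxx (eq_of_distX_eq_zero P h.symm)
      rw [distX_K_eq] at hle hpos
      rw [distX_K_eq, div_le_iff₀ (Real.rpow_pos_of_pos hpos ε)]
      have hb := holder_bound (α := ε) (adm := fun b b' : Tor (fine (nP P) (MP P)) => True ∧ distU (nP P) (MP P) b b' ≤ 1)
        (dist := distU (nP P) (MP P)) (τ := fun _ _ => id) (S := Finset.univ) F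
        (Finset.mem_univ (eFine P x)) (Finset.mem_univ (eFine P x')) ⟨trivial, hle⟩ hpos
      rw [Real.norm_eq_abs] at hb
      exact hb
  · exact hH0

/-- the same for a vector component with `sameDir := (same bond direction)`. [cite: Balaban1984PropagatorsI, (1.109) p.35] -/
theorem holN_pull_le (ε : ℝ) (F : Tor (fine (nP P) (MP P)) × Fin P.d → ℝ) (μ : Fin P.d) :
    holN P P.K ε (pullV P F μ)
      ≤ holderSeminormB5 ε (fun b b' : Tor (fine (nP P) (MP P)) × Fin P.d => b.2 = b'.2)
          (fun b b' => distU (nP P) (MP P) b.1 b'.1) Finset.univ (fun b => (F b : ℂ)) := by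
  set H := holderSeminormB5 ε (fun b b' : Tor (fine (nP P) (MP P)) × Fin P.d => b.2 = b'.2)
      (fun b b' => distU (nP P) (MP P) b.1 b'.1) Finset.univ (fun b => (F b : ℂ)) with hH
  have hH0 : 0 ≤ H := holderSeminorm_nonneg _ _ _ _ _ _
  refine Finset.sup'_le _ _ fun p _ => ?_
  obtain ⟨x, x'⟩ := p
  dsimp only
  split_ifs with hle
  · by_cases hxx : x = x'
    · subst hxx
      rw [sub_self, abs_zero, zero_div]
      exact hH0
    · have hpos : 0 < distX P P.K x x' :=
        lt_of_le_of_ne (by unfold distX; have := T_nonneg P 0 x x'; positivity) fun h => hxx (eq_of_distX_eq_zero P h.symm)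
      rw [distX_K_eq] at hle hpos
      rw [distX_K_eq, div_le_iff₀ (Real.rpow_pos_of_pos hpos ε)]
      have hb := holder_bound (α := ε) (adm := fun b b' : Tor (fine (nP P) (MP P)) × Fin P.d =>
          b.2 = b'.2 ∧ distU (nP P) (MP P) b.1 b'.1 ≤ 1)
        (dist := fun b b' => distU (nP P) (MP P) b.1 b'.1) (τ := fun _ _ => id) (S := Finset.univ) (fun b => (F b : ℂ))
        (Finset.mem_univ (eFine P x, μ)) (Finset.mem_univ (eFine P x', μ)) ⟨rfl, hle⟩ hpos
      simp only [id] at hb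
      rw [← Complex.ofReal_sub, Complex.norm_real, Real.norm_eq_abs] at hb
      exact hb
  · exact hH0

/-- **`holder_map` (vector kind): `‖pullV F‖_ε ≤ ‖F‖_ε`** (p37's `holderV P K` vs `B5Prop12FieldsLattice.holderV`).
[cite: Balaban1984PropagatorsI, (1.109) p.35] -/
theorem holderV_pullV_le (ε : ℝ) (F : Tor (fine (nP P) (MP P)) × Fin P.d → ℝ) :
    holderV P P.K ε (pullV P F) ≤ B5Prop12FieldsLattice.holderV (nP P) (MP P) ε (fun b => (F b : ℂ)) :=
  Finset.sup'_le _ _ fun μ _ => holN_pull_le P ε F μ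

/-- **`cutH_map`: `‖κ ζ‖_α + |κ ζ| ≤ ‖ζ‖_α + |ζ|`.** [cite: Balaban1984PropagatorsI, (1.111) p.35] -/
theorem cutHV_κR_le (α : ℝ) (ζ : Tor (fine (nP P) (MP P)) → ℝ) : cutHV P P.K α (κR P ζ) ≤ cutHL (nP P) (MP P) α ζ :=
  add_le_add (holN_comp_le P α ζ) (supN_κR_le P ζ)

end

end Literature.MathematicalPhysics.QuantumFieldTheory.Balaban1983to89.B5Carrier132Maps
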